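import Summits.ValiantsHypothesis.ValiantsHypothesis.Theses.FermionizationDimension

/-!
# Route FermionizationDimension — crux `SDimPerNotQP` (stmt-ValiantsHypothesis-7286):
# the linear lower bound on the commutative twisting dimension, and `SDimUnbounded`

Registered auxiliary stubs `stub_linearLowerBound` and `stub_sDimUnbounded` of the line `registered`
(`Cruxes/SDimPerNotQP/Lines/birth.lean`) of the crux `SDimPerNotQP`.

**Theorem (linear lower bound).** If a commutative finite-dimensional `ℂ`-algebra `R`, twists
`u : Fin n → Fin n → R` and a functional `ℓ : R →ₗ[ℂ] ℂ` realise the sign character,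
`ℓ (∏ i, u (σ i) i) = sgn σ` for all `σ ∈ 𝔖ₙ`, then `n ≤ 2 · finrank ℂ R`. In the route's notation
`s(n) ≥ ⌈n/2⌉` (and, reduced case, `tdr(per_n) ≥ ⌈n/2⌉`); previously only `s(n) ≥ 2` (`n ≥ 3`,
Pólya–Szegő / Marcus–Minc) was known, and the route header records "even `s(n) ≥ 3` unprinted".

**Corollary.** `SDimUnbounded` (the route's rank-4 crux, stmt-ValiantsHypothesis-7288): for every `s₀`
and all `n ≥ 2 s₀ + 1`, no commutative algebra of dimension `≤ s₀` realises `sgn_n`.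

**Proof (descent by a character; weights).** We prove the stronger weighted statement: if
`ℓ (θ · ∏ i, u (σ i) i) = sgn σ` for all `σ` then `n ≤ 2 · finrank ℂ (θR)`. Since `θ ≠ 0`, the
annihilator of `θ` is a proper ideal, so some character `χ : R →ₐ[ℂ] ℂ` kills it (a maximal ideal
above it has residue field `ℂ`). Put `a = χ ∘ u`.
* If some `a j i = 0`, move `(j,i)` to `(0,0)` by a row and a column transposition (the functional
  picks up the two signs) and restrict to the permutations fixing `0`: the weight becomes
  `θ' = θ · u 0 0` with `χ (u 0 0) = 0`, realising `sgn_{n-1}` on the minor.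
* Otherwise all residues are nonzero and `n ≥ 3`. Among the three `2 × 2` blocks of rows `0,1` and
  columns `0,1,2` one has nonzero residue PERMANENT `a₀ᵢ a₁ᵢ' + a₁ᵢ a₀ᵢ' ≠ 0` (if all three vanished,
  `2 a₀₁ a₁₀ a₀₂ = a₀₂·A − a₀₀·C + a₀₁·B = 0`). Move it to columns `0,1` and contract:
  with `c = (a₀₀a₁₁)⁻¹`, `c' = (a₁₀a₀₁)⁻¹` and `Θ = c·u₀₀u₁₁ − c'·u₁₀u₀₁` one has `χ Θ = 0` and, pairing
  `σ` with `σ ∘ (0 1)`, `ℓ (θΘ · minor product) = (c + c') · sgn`, `c + c' ≠ 0`; so `θ' = θΘ`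
  realises `sgn_{n-2}` on the minor.
In both cases `θ' R ⊊ θ R` strictly: `θ' R = θ R` would give `θ (1 − Θ r) = 0`, hence
`χ (1 − Θ r) = 0`, i.e. `1 = 0`. Induction on `n` gives `n ≤ 2 · finrank (θR)`; take `θ = 1`.

Sources: the `n = 3`, `finrank = 1` case is Pólya–Szegő (1913) / MarcusMinc1961 (BrualdiRyser1991
Thm 7.5.1); the descent is new here (folklore-level linear algebra).
-/

set_option linter.dupNamespace false

namespace Summit.ValiantsHypothesis.ValiantsHypothesis.Theorems

namespace FermionizationDimensionSDimPerNotQPLinearLowerBound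

open Equiv

variable {R : Type} [CommRing R] [Algebra ℂ R]

/-- Signs are square roots of one: `(sgn π)² = 1` in `ℂ`. [folklore] -/
theorem sign_mul_self {n : ℕ} (π : Perm (Fin n)) :
    ((Perm.sign π : ℤ) : ℂ) * ((Perm.sign π : ℤ) : ℂ) = 1 := by
  rw [← Int.cast_mul, ← Units.val_mul, Int.units_mul_self, Units.val_one, Int.cast_one]

/-- **Column permutation.** A weighted realisation of `sgn_n` stays one after permuting the
columns of `u` by `π` and multiplying the functional by `sgn π`. [folklore] -/
theorem weighted_colPerm {n : ℕ} (θ : R) (u : Fin n → Fin n → R) (ℓ : R →ₗ[ℂ] ℂ)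
    (h : ∀ σ : Perm (Fin n), ℓ (θ * ∏ i, u (σ i) i) = ((Perm.sign σ : ℤ) : ℂ))
    (π : Perm (Fin n)) :
    ∀ σ : Perm (Fin n),
      (((Perm.sign π : ℤ) : ℂ) • ℓ) (θ * ∏ i, u (σ i) (π i)) = ((Perm.sign σ : ℤ) : ℂ) := by
  intro σ
  have hprod : ∏ i, u (σ i) (π i) = ∏ i, u ((σ * π⁻¹) i) i := by
    calc ∏ i, u (σ i) (π i) = ∏ i, u ((σ * π⁻¹) (π i)) (π i) := by
          simp [Perm.mul_apply]
      _ = ∏ i, u ((σ * π⁻¹) i) i := Equiv.prod_comp π (fun k => u ((σ * π⁻¹) k) k)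
  rw [LinearMap.smul_apply, hprod, h (σ * π⁻¹), smul_eq_mul, Perm.sign_mul, Perm.sign_inv,
    Units.val_mul, Int.cast_mul]
  calc ((Perm.sign π : ℤ) : ℂ) * (((Perm.sign σ : ℤ) : ℂ) * ((Perm.sign π : ℤ) : ℂ))
        = ((Perm.sign σ : ℤ) : ℂ) * (((Perm.sign π : ℤ) : ℂ) * ((Perm.sign π : ℤ) : ℂ)) := by ring
    _ = ((Perm.sign σ : ℤ) : ℂ) := by rw [sign_mul_self, mul_one]

/-- **Row permutation.** A weighted realisation of `sgn_n` stays one after permuting the rows of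
`u` by `π` and multiplying the functional by `sgn π`. [folklore] -/
theorem weighted_rowPerm {n : ℕ} (θ : R) (u : Fin n → Fin n → R) (ℓ : R →ₗ[ℂ] ℂ)
    (h : ∀ σ : Perm (Fin n), ℓ (θ * ∏ i, u (σ i) i) = ((Perm.sign σ : ℤ) : ℂ))
    (π : Perm (Fin n)) :
    ∀ σ : Perm (Fin n),
      (((Perm.sign π : ℤ) : ℂ) • ℓ) (θ * ∏ i, u (π (σ i)) i) = ((Perm.sign σ : ℤ) : ℂ) := by
  intro σ
  have hprod : ∏ i, u (π (σ i)) i = ∏ i, u ((π * σ) i) i := by simp [Perm.mul_apply]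
  rw [LinearMap.smul_apply, hprod, h (π * σ), smul_eq_mul, Perm.sign_mul, Units.val_mul,
    Int.cast_mul, ← mul_assoc, sign_mul_self, one_mul]

/-- **Restriction at `(0,0)`.** From a weighted realisation of `sgn_{m+1}`, the permutations fixing
`0` give a weighted realisation of `sgn_m` on the minor, with weight `θ · u 0 0`. [folklore] -/
theorem weighted_restrict_zero {m : ℕ} (θ : R) (u : Fin (m + 1) → Fin (m + 1) → R)
    (ℓ : R →ₗ[ℂ] ℂ)
    (h : ∀ σ : Perm (Fin (m + 1)), ℓ (θ * ∏ i, u (σ i) i) = ((Perm.sign σ : ℤ) : ℂ)) :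
    ∀ e : Perm (Fin m),
      ℓ ((θ * u 0 0) * ∏ i, u (e i).succ i.succ) = ((Perm.sign e : ℤ) : ℂ) := by
  intro e
  have h1 := h (Perm.decomposeFin.symm (0, e))
  rw [Fin.prod_univ_succ] at h1
  simp only [Perm.decomposeFin_symm_apply_zero, Perm.decomposeFin_symm_apply_succ, swap_self,
    Equiv.refl_apply, Perm.decomposeFin.symm_sign, if_true, one_mul] at h1
  rw [← h1, mul_assoc]

/-- **Contraction of the `2 × 2` block at rows `0,1`, columns `0,1`.** From a weighted realisation
of `sgn_{m+2}`, pairing `σ` (fixing `0` and `1`) with `σ ∘ (0 1)`: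
`ℓ (θ · (c·u₀₀u₁₁ − c'·u₁₀u₀₁) · minor product) = (c + c') · sgn`. [folklore] -/
theorem weighted_restrict_two {m : ℕ} (θ : R) (u : Fin (m + 2) → Fin (m + 2) → R)
    (ℓ : R →ₗ[ℂ] ℂ)
    (h : ∀ σ : Perm (Fin (m + 2)), ℓ (θ * ∏ i, u (σ i) i) = ((Perm.sign σ : ℤ) : ℂ))
    (c c' : ℂ) :
    ∀ e : Perm (Fin m),
      ℓ ((θ * (c • (u 0 0 * u 1 1) - c' • (u 1 0 * u 0 1))) *
          ∏ i, u (e i).succ.succ i.succ.succ) = (c + c') * ((Perm.sign e : ℤ) : ℂ) := by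
  intro e
  set σ : Perm (Fin (m + 2)) := Perm.decomposeFin.symm (0, Perm.decomposeFin.symm (0, e))
    with hσ
  have hσ0 : σ 0 = 0 := by simp [hσ]
  have hσ1 : σ 1 = 1 := by simp [hσ]
  have hσss : ∀ x : Fin m, σ x.succ.succ = (e x).succ.succ := by
    intro x; simp [hσ]
  have hsign : Perm.sign σ = Perm.sign e := by simp [hσ]
  have h01 : (0 : Fin (m + 2)) ≠ 1 := zero_ne_one
  -- the two permutations `σ` and `σ ∘ (0 1)`
  have h1 := h σ
  have h2 := h (σ * swap 0 1)
  rw [Fin.prod_univ_succ, Fin.prod_univ_succ] at h1 h2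
  simp only [Fin.succ_zero_eq_one, hσ0, hσ1, hσss, hsign] at h1
  have hss : ∀ x : Fin m, (σ * swap (0 : Fin (m + 2)) 1) x.succ.succ = (e x).succ.succ := by
    intro x
    rw [Perm.mul_apply, swap_apply_of_ne_of_ne (Fin.succ_ne_zero _) (Fin.succ_succ_ne_one _),
      hσss]
  simp only [Fin.succ_zero_eq_one, Perm.mul_apply, swap_apply_left, swap_apply_right, hσ0, hσ1,
    hss, Perm.sign_mul, Perm.sign_swap h01, hsign, Units.val_neg, Int.cast_neg, mul_neg,
    mul_one] at h2
  -- expand the contraction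
  have key : (θ * (c • (u 0 0 * u 1 1) - c' • (u 1 0 * u 0 1))) *
        ∏ i, u (e i).succ.succ i.succ.succ =
      c • (θ * (u 0 0 * (u 1 1 * ∏ i, u (e i).succ.succ i.succ.succ))) -
        c' • (θ * (u 1 0 * (u 0 1 * ∏ i, u (e i).succ.succ i.succ.succ))) := by
    simp only [Algebra.smul_def]
    ring
  rw [key, map_sub, map_smul, map_smul, h1, h2, smul_eq_mul, smul_eq_mul]
  ring

/-- **Strict drop of the potential.** If `χ` is a character killing the annihilator of `θ` and
`χ Θ = 0`, then `θΘR ⊊ θR`, so `finrank (θΘR) + 1 ≤ finrank (θR)`. [folklore] -/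
theorem finrank_range_mulLeft_lt [Module.Finite ℂ R] (θ Θ : R) (χ : R →ₐ[ℂ] ℂ)
    (hχ : ∀ x, θ * x = 0 → χ x = 0) (hΘ : χ Θ = 0) :
    Module.finrank ℂ (LinearMap.range (LinearMap.mulLeft ℂ (θ * Θ))) + 1 ≤
      Module.finrank ℂ (LinearMap.range (LinearMap.mulLeft ℂ θ)) := by
  apply Nat.succ_le_of_lt
  apply Submodule.finrank_lt_finrank_of_lt
  rw [lt_iff_le_and_ne]
  refine ⟨?_, ?_⟩
  · rintro _ ⟨x, rfl⟩
    exact ⟨Θ * x, by simp only [LinearMap.mulLeft_apply]; ring⟩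
  · intro heq
    have hmem : θ ∈ LinearMap.range (LinearMap.mulLeft ℂ θ) := ⟨1, by simp⟩
    rw [← heq] at hmem
    obtain ⟨r, hr⟩ := hmem
    simp only [LinearMap.mulLeft_apply] at hr
    have h0 : θ * (1 - Θ * r) = 0 := by
      rw [mul_sub, mul_one, ← mul_assoc, hr, sub_self]
    have h1 := hχ _ h0
    rw [map_sub, map_one, map_mul, hΘ, zero_mul, sub_zero] at h1
    exact one_ne_zero h1

/-- **Characters.** A nonzero `θ` in a finite-dimensional commutative `ℂ`-algebra has a character
`χ : R →ₐ[ℂ] ℂ` killing its annihilator (a maximal ideal above `Ann θ`; the residue field, finite over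
the algebraically closed `ℂ`, is `ℂ`). [folklore] -/
theorem exists_char [Module.Finite ℂ R] (θ : R) (hθ : θ ≠ 0) :
    ∃ χ : R →ₐ[ℂ] ℂ, ∀ x, θ * x = 0 → χ x = 0 := by
  let A : Ideal R := LinearMap.ker (LinearMap.mulLeft R θ)
  have hA : A ≠ ⊤ := by
    intro htop
    have h1 : (1 : R) ∈ A := htop ▸ Submodule.mem_top
    have : θ * 1 = 0 := h1
    exact hθ (by simpa using this)
  obtain ⟨M, hM, hAM⟩ := Ideal.exists_le_maximal A hA
  let ρ : (R ⧸ M) ≃ₐ[ℂ] ℂ :=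
    (AlgEquiv.ofBijective (Algebra.ofId ℂ (R ⧸ M))
      IsAlgClosed.algebraMap_bijective_of_isIntegral).symm
  refine ⟨ρ.toAlgHom.comp (Ideal.Quotient.mkₐ ℂ M), fun x hx => ?_⟩
  have hxA : x ∈ A := hx
  have hxM : x ∈ M := hAM hxA
  have hx0 : Ideal.Quotient.mkₐ ℂ M x = 0 :=
    (Ideal.Quotient.mkₐ_eq_mk ℂ M ▸ Ideal.Quotient.eq_zero_iff_mem.2 hxM :)
  rw [AlgHom.comp_apply, hx0, map_zero]

/-- **The `2 × 3` lemma.** Six nonzero complex numbers arranged in two rows and three columns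
cannot have all three `2 × 2` permanents zero: `2·a₀₁a₁₀a₀₂ = a₀₂·A − a₀₀·C + a₀₁·B`. [folklore] -/
theorem not_all_per_null {a00 a01 a02 a10 a11 a12 : ℂ} (h01 : a01 ≠ 0) (h02 : a02 ≠ 0)
    (h10 : a10 ≠ 0) (hA : a00 * a11 + a10 * a01 = 0) (hB : a00 * a12 + a10 * a02 = 0)
    (hC : a01 * a12 + a11 * a02 = 0) : False := by
  have h : 2 * a01 * a10 * a02 = 0 := by
    linear_combination a02 * hA - a00 * hC + a01 * hB
  exact (mul_ne_zero (mul_ne_zero (mul_ne_zero two_ne_zero h01) h10) h02) h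

/-- **The weighted descent.** If `ℓ (θ · ∏ i, u (σ i) i) = sgn σ` for all `σ ∈ 𝔖ₙ` then
`n ≤ 2 · finrank ℂ (θR)`. Strong induction on `n`: restrict at an entry whose residue vanishes, or
contract a `2 × 2` block with nonzero residue permanent; the weight picks up a factor in the
kernel of the character and the potential `finrank (θR)` drops strictly. [new; folklore-level] -/
theorem weighted_bound [Module.Finite ℂ R] (n : ℕ) :
    ∀ (θ : R) (u : Fin n → Fin n → R) (ℓ : R →ₗ[ℂ] ℂ),
      (∀ σ : Perm (Fin n), ℓ (θ * ∏ i, u (σ i) i) = ((Perm.sign σ : ℤ) : ℂ)) →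
      n ≤ 2 * Module.finrank ℂ (LinearMap.range (LinearMap.mulLeft ℂ θ)) := by
  induction n using Nat.strong_induction_on with
  | _ n ih =>
  intro θ u ℓ h
  -- the weight is nonzero, so the potential is positive
  have hθ : θ ≠ 0 := by
    intro h0
    have h1 := h 1
    simp [h0] at h1
  have hP : 1 ≤ Module.finrank ℂ (LinearMap.range (LinearMap.mulLeft ℂ θ)) := by
    rw [Nat.one_le_iff_ne_zero]
    intro h0
    have hbot := Submodule.finrank_eq_zero.1 h0
    have hmem : θ ∈ LinearMap.range (LinearMap.mulLeft ℂ θ) := ⟨1, by simp⟩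
    rw [hbot, Submodule.mem_bot] at hmem
    exact hθ hmem
  rcases Nat.lt_or_ge n 3 with hn | hn
  · omega
  obtain ⟨k, rfl⟩ : ∃ k, n = k + 3 := ⟨n - 3, by omega⟩
  obtain ⟨χ, hχ⟩ := exists_char θ hθ
  by_cases hz : ∃ j i, χ (u j i) = 0
  · -- Case A: an entry with vanishing residue; move it to `(0,0)` and restrict.
    obtain ⟨j₀, i₀, hji⟩ := hz
    have hrow := weighted_rowPerm θ u ℓ h (swap 0 j₀)
    have hcol := weighted_colPerm θ (fun j i => u (swap 0 j₀ j) i)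
      (((Perm.sign (swap (0 : Fin (k + 3)) j₀) : ℤ) : ℂ) • ℓ) hrow (swap 0 i₀)
    have hres := weighted_restrict_zero (m := k + 2) θ
      (fun j i => u (swap 0 j₀ j) (swap 0 i₀ i)) _ hcol
    simp only [swap_apply_left] at hres
    have hIH := ih (k + 2) (by omega) (θ * u j₀ i₀)
      (fun j i => u (swap 0 j₀ j.succ) (swap 0 i₀ i.succ)) _ hres
    have hdrop := finrank_range_mulLeft_lt θ (u j₀ i₀) χ hχ hji
    omega
  · -- Case B: all residues are nonzero; contract a `2 × 2` block with nonzero residue permanent.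
    push Not at hz
    have h2mod : (2 : ℕ) % (k + 3) = 2 := Nat.mod_eq_of_lt (by omega)
    -- a column permutation bringing a good block of rows `0,1` to columns `0,1`
    have hgood : ∃ π : Perm (Fin (k + 3)),
        χ (u 0 (π 0)) * χ (u 1 (π 1)) + χ (u 1 (π 0)) * χ (u 0 (π 1)) ≠ 0 := by
      by_cases hA : χ (u 0 0) * χ (u 1 1) + χ (u 1 0) * χ (u 0 1) = 0
      · by_cases hB : χ (u 0 0) * χ (u 1 2) + χ (u 1 0) * χ (u 0 2) = 0
        · have hC : χ (u 0 1) * χ (u 1 2) + χ (u 1 1) * χ (u 0 2) ≠ 0 :=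
            fun hC => not_all_per_null (hz 0 1) (hz 0 2) (hz 1 0) hA hB hC
          refine ⟨swap 0 2, ?_⟩
          have h20 : swap (0 : Fin (k + 3)) 2 0 = 2 := swap_apply_left _ _
          have h21 : swap (0 : Fin (k + 3)) 2 1 = 1 :=
            swap_apply_of_ne_of_ne (by simp) (by simp [Fin.ext_iff, h2mod])
          rw [h20, h21]
          intro hC'
          apply hC
          linear_combination hC'
        · refine ⟨swap 1 2, ?_⟩
          have h10 : swap (1 : Fin (k + 3)) 2 0 = 0 :=
            swap_apply_of_ne_of_ne (by simp) (by simp [Fin.ext_iff, h2mod])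
          have h11 : swap (1 : Fin (k + 3)) 2 1 = 2 := swap_apply_left _ _
          rw [h10, h11]
          exact hB
      · exact ⟨1, by simpa using hA⟩
    obtain ⟨π, hπ⟩ := hgood
    have hcol := weighted_colPerm θ u ℓ h π
    -- the contraction constants
    set p : ℂ := χ (u 0 (π 0)) * χ (u 1 (π 1)) with hp_def
    set p' : ℂ := χ (u 1 (π 0)) * χ (u 0 (π 1)) with hp'_def
    have hp : p ≠ 0 := mul_ne_zero (hz _ _) (hz _ _)
    have hp' : p' ≠ 0 := mul_ne_zero (hz _ _) (hz _ _)
    have hcc' : p⁻¹ + p'⁻¹ ≠ 0 := by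
      intro h0
      apply hπ
      calc p + p' = (p⁻¹ * p) * p' + (p'⁻¹ * p') * p := by
            rw [inv_mul_cancel₀ hp, inv_mul_cancel₀ hp', one_mul, one_mul, add_comm]
        _ = (p⁻¹ + p'⁻¹) * (p * p') := by ring
        _ = 0 := by rw [h0, zero_mul]
    set Θ : R := p⁻¹ • (u 0 (π 0) * u 1 (π 1)) - p'⁻¹ • (u 1 (π 0) * u 0 (π 1)) with hΘdef
    have hres := weighted_restrict_two (m := k + 1) θ (fun j i => u j (π i)) _ hcol p⁻¹ p'⁻¹
    beta_reduce at hres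
    have hres' : ∀ e : Perm (Fin (k + 1)),
        ((p⁻¹ + p'⁻¹)⁻¹ • (((Perm.sign π : ℤ) : ℂ) • ℓ))
          ((θ * Θ) * ∏ i, u (e i).succ.succ (π i.succ.succ)) = ((Perm.sign e : ℤ) : ℂ) := by
      intro e
      rw [LinearMap.smul_apply, hΘdef, hres e, smul_eq_mul, ← mul_assoc, inv_mul_cancel₀ hcc',
        one_mul]
    have hIH := ih (k + 1) (by omega) (θ * Θ) (fun j i => u j.succ.succ (π i.succ.succ)) _ hres'
    have hΘ : χ Θ = 0 := by
      rw [hΘdef, map_sub, map_smul, map_smul, map_mul, map_mul, smul_eq_mul, smul_eq_mul,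
        ← hp_def, ← hp'_def, inv_mul_cancel₀ hp, inv_mul_cancel₀ hp', sub_self]
    have hdrop := finrank_range_mulLeft_lt θ Θ χ hχ hΘ
    omega

end FermionizationDimensionSDimPerNotQPLinearLowerBound

open FermionizationDimensionSDimPerNotQPLinearLowerBound in
/-- **Linear lower bound on the commutative twisting dimension** (registered auxiliary stub
`stub_linearLowerBound` of the line `registered` of crux `SDimPerNotQP`, stmt-ValiantsHypothesis-7286).
Every commutative realisation `(R, u, ℓ)` of `sgn_n` — `ℓ (∏ i, u (σ i) i) = sgn σ` for all
`σ ∈ 𝔖ₙ` over a finite-dimensional commutative `ℂ`-algebra `R` — has `n ≤ 2 · finrank ℂ R`, i.e.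
`s(n) ≥ ⌈n/2⌉`. Proof: the weighted descent `weighted_bound` with `θ = 1`. [new; the case
`n = 3` is Pólya–Szegő 1913 / MarcusMinc1961, BrualdiRyser1991 Thm 7.5.1] -/
theorem stub_linearLowerBound :
    ∀ (n : ℕ) (R : Type) [CommRing R] [Algebra ℂ R] [Module.Finite ℂ R] (u : Fin n → Fin n → R) (ℓ : R →ₗ[ℂ] ℂ), (∀ σ : Equiv.Perm (Fin n), ℓ (∏ i, u (σ i) i) = ((Equiv.Perm.sign σ : ℤ) : ℂ)) → n ≤ 2 * Module.finrank ℂ R := by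
  intro n R _ _ _ u ℓ h
  have hw := weighted_bound n (1 : R) u ℓ (by simpa using h)
  have htop : LinearMap.range (LinearMap.mulLeft ℂ (1 : R)) = ⊤ :=
    LinearMap.range_eq_top.2 fun x => ⟨x, by simp⟩
  rw [htop, finrank_top] at hw
  exact hw

/-- **`SDimUnbounded` — the route's rank-4 crux (stmt-ValiantsHypothesis-7288), proved**
(registered auxiliary stub `stub_sDimUnbounded` of the line `registered` of crux `SDimPerNotQP`):
`s(n) → ∞` — for every `s₀` and all `n ≥ 2 s₀ + 1`, no commutative `ℂ`-algebra of dimension `≤ s₀`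
realises the sign character of `𝔖ₙ` multiplicatively. Immediate from the linear lower bound
`n ≤ 2 · finrank ℂ R` (`stub_linearLowerBound`). [new] -/
theorem stub_sDimUnbounded :
    Summit.ValiantsHypothesis.ValiantsHypothesis.Theses.FermionizationDimension.SDimUnbounded := by
  intro s₀
  refine ⟨2 * s₀ + 1, fun n hn R _ _ _ u ℓ h => ?_⟩
  have := stub_linearLowerBound n R u ℓ h
  omega

end Summit.ValiantsHypothesis.ValiantsHypothesis.Theorems
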